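/-
COR-CM (cells pub-hodgecm / pub-hodgecm2, stage 2 of the Hodge ladder) — TRANSPOSITION item (vi), S-LANE, CARRIERS-PLAN row 9 residual (ρ1):
the two inputs `𝓢` (DATA) and `hfac` (its local–global factorisation) of the row-9 consumer junction
`Model.hirr_of_lemD1AsPrinted_row9` (✔ p329944, `Transposition/Item6HirrOfLemD1AsPrinted.lean`) SUPPLIED AS TREE TERMS at the END display's
carriers: `OmegaMuSplitting.muLocalSplittings F ι₁ V Φ a` = the LOCAL SPLITTINGS of `U(diag V.diagEntries ⊗ (a))(F⁺_v)` attached to `μ(Φ, ι₁)`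
— the `χ_μ`-normalised CM package of the doubled group (GR-2 `cmFinLocalFamily`, Kudla's splitting place by place) UNDOUBLED place by place
(pin-1 `FinLocalSplittings.undouble`, GR-1 `undoubleLoc`), read on the consumers' Gram data (`congrW`) — and
`OmegaMuSplitting.hfac_sMu` : the displayed `χ_μ`-attached global splitting `sMu F ι₁ V Φ a` (the undoubling of THE `χ_μ`-normalised doubled
Weil representation, (α-2) ✔ p323278) restricted to the finite-adelic pair IS the reference section assembled from `muLocalSplittings`
(«undoubling commutes with place-assembly», `GelbartRogawski1991/UndoublingPlaceAssembly.lean`).  Seat prover-pub-hodgecm-own-htheta-g6-0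
(own-htheta gen 6, (ρ1) owner; rule-(1) blanket `Transposition/Item6*`).  ONE def (data, constructed) + ONE theorem; no named fact; nothing
landed is edited.  HC_CM is NOT proved; this moves no pointer: it makes (ρ1) a tree term so that the END re-cut `hirr ↦ hD1` can consume
`Model.hirr_of_lemD1AsPrinted_row9 … (muLocalSplittings …) (hfac_sMu …) …`.
-/
import Summits.HodgeConjecture.CorCM.B01.Transposition.Item6OmegaMuSplittingUnique
import Literature.NumberTheory.GelbartRogawski1991.UndoublingPlaceAssembly
import Literature.NumberTheory.GelbartRogawski1991.DoubledWeilRepresentationCMExplicit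
import HarnessLib

set_option autoImplicit false

/-!
# (ρ1) at the END display's carriers: the μ-attached local splittings and the factorisation `hfac` of `sMu`

* `OmegaMuSplitting.muLocalSplittings F ι₁ V Φ a` — `congrW (realDiagonal_lineW) (diagonal_lineW) (undoubledSplittings (cmFinLocalFamily χ_μ …))`:
  the local undoublings of the `χ_μ`-normalised doubled CM package, `χ_μ = chiMu F ι₁ Φ`, on the Gram data `(diag V.diagEntries, J_W a)`.
* `OmegaMuSplitting.hfac_sMu F ι₁ V Φ a` —
  `(pairSmall₁ … (sMu F ι₁ V Φ a)).comp (finPairToAdelic …) = localRefSection … (muLocalSplittings F ι₁ V Φ a)`.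
HC_CM is NOT proved.
-/

noncomputable section

open scoped Matrix Kronecker TensorProduct

namespace Summit.HodgeConjecture.CorCM.Transposition.OmegaMuSplitting

open NumberField IsDedekindDomain MeasureTheory
open Literature.AlgebraicGeometry.Motives (CMType)
open Literature.NumberTheory.Automorphic
open Literature.NumberTheory.Automorphic.Liu2021.Def411WeilCarriers (JW TW isSymm_TW isUnit_det_TW JW_eq)
open Literature.NumberTheory.Automorphic.Liu2021.Def411WeilCarriersDoubling
open Literature.NumberTheory.GelbartRogawski1991 Literature.NumberTheory.GelbartRogawski1991.UnitaryDualPair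
open Literature.NumberTheory.GelbartRogawski1991.UnitaryDualPair.WeilCoinv
open Literature.NumberTheory.GelbartRogawski1991.UnitaryDualPair.LocalSplitting
open Literature.NumberTheory.GelbartRogawski1991.GRConstruction
open Literature.NumberTheory.Weil1964

/-- **the μ-attached LOCAL SPLITTINGS at the line `⟨a⟩`** (CARRIERS-PLAN row 9, residual (ρ1), the DATA `𝓢`): the `χ_μ`-normalised
per-place package of the doubled group `U(diag V.diagEntries ⊗ (a) ⊕ −)` (`cmFinLocalFamily` at `χ_μ = chiMu F ι₁ Φ`, Haar data of record),
undoubled place by place (`undoubledSplittings` = `FinLocalSplittings.undouble`), read on the consumers' Gram data `T_W = TW a`,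
`J_W = JW a` (`congrW` along `realDiagonal_lineW` ∕ `diagonal_lineW`).  Liu's `ι_{μ_v}` at every finite place, as a tree term.
[cite: GelbartRogawski1991, §3.1 Prop. 3.1.1 p. 455 L1–3] [cite: Liu2021, App. D §D.1 Step 2 (l. 5219)] -/
def muLocalSplittings (F : CMField) (ι₁ : F →+* ℂ) (V : HermSpace3 F ι₁) (Φ : CMType F) (a : (↥(maximalRealSubfield F))ˣ) :
    FinLocalSplittings ↥(maximalRealSubfield F) F (IsCMField.complexConj F) (3 * 1) (complexConj_imagUnit F) (imagUnit_ne_zero F)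
      (imagUnit_mul_self F)
      (gram ↥(maximalRealSubfield F) finProdFinEquiv (realDiagonal F V.diagEntries V.complexConj_diagEntries) (TW ↥(maximalRealSubfield F) a))
      (isSymm_gram ↥(maximalRealSubfield F) finProdFinEquiv (realDiagonal_isSymm F V.diagEntries V.complexConj_diagEntries)
        (isSymm_TW ↥(maximalRealSubfield F) a))
      (J := Matrix.reindex finProdFinEquiv finProdFinEquiv (Matrix.diagonal V.diagEntries ⊗ₖ JW ↥(maximalRealSubfield F) F a))
      (reindex_kronecker_eq_gram_map ↥(maximalRealSubfield F) F finProdFinEquiv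
        (realDiagonal_map F V.diagEntries V.complexConj_diagEntries).symm (JW_eq ↥(maximalRealSubfield F) F a)) :=
  congrW F finProdFinEquiv V.diagEntries V.complexConj_diagEntries (lineW F (TW ↥(maximalRealSubfield F) a))
    (complexConj_lineW F (TW ↥(maximalRealSubfield F) a)) (realDiagonal_lineW F (TW ↥(maximalRealSubfield F) a))
    (diagonal_lineW F (TW ↥(maximalRealSubfield F) a) (JW_eq ↥(maximalRealSubfield F) F a))
    (undoubledSplittings F finProdFinEquiv V.diagEntries V.complexConj_diagEntries V.diagEntries_ne_zero
      (lineW F (TW ↥(maximalRealSubfield F) a)) (complexConj_lineW F (TW ↥(maximalRealSubfield F) a))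
      (lineW_ne_zero F (TW ↥(maximalRealSubfield F) a) (isUnit_det_TW ↥(maximalRealSubfield F) a)) (chiMu F ι₁ Φ)
      (borelPlaceMeasure F)
      (cmFinLocalFamily F finProdFinEquiv V.diagEntries V.complexConj_diagEntries V.diagEntries_ne_zero
        (lineW F (TW ↥(maximalRealSubfield F) a)) (complexConj_lineW F (TW ↥(maximalRealSubfield F) a))
        (lineW_ne_zero F (TW ↥(maximalRealSubfield F) a) (isUnit_det_TW ↥(maximalRealSubfield F) a)) (chiMu F ι₁ Φ)
        (chiMu_isSplittingChar F ι₁ Φ) (borelPlaceMeasure F)))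
    (isSymm_TW ↥(maximalRealSubfield F) a) (JW_eq ↥(maximalRealSubfield F) F a)

set_option maxHeartbeats 4000000 in
/-- **`hfac` for the displayed splitting** (CARRIERS-PLAN row 9, residual (ρ1)): the `χ_μ`-attached splitting `sMu F ι₁ V Φ a`, read on the
finite-adelic pair `U(diag V.diagEntries)(𝔸_f) × U(J_W a)(𝔸_f)`, IS the reference section assembled from `muLocalSplittings F ι₁ V Φ a`:
`sMu = splittingCongr … (undoubleHom (cmDoubledWeilRep χ_μ …))` by (α-2) `sMu_eq_splittingCongr_undoubleHom` at the EXPLICIT `χ_μ`-normalised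
doubled Weil representation `assemble (finHalf (cmFinLocalFamily χ_μ …)) sa` (any archimedean half `sa`, `exists_isArchHalf`), then
«undoubling commutes with place-assembly» (`pairSmall₁_splittingCongr_undoubleHom_assemble_eq_localRefSection`).
[cite: GelbartRogawski1991, §3.1 Prop. 3.1.1 p. 455 L1–3, Remark p. 457 L4–13] [cite: Liu2021, App. D §D.1 Step 2 (l. 5219)] -/
theorem hfac_sMu (F : CMField) (ι₁ : F →+* ℂ) (V : HermSpace3 F ι₁) (Φ : CMType F) (a : (↥(maximalRealSubfield F))ˣ) :
    (pairSmall₁ ↥(maximalRealSubfield F) F (IsCMField.complexConj F) 3 1 finProdFinEquiv (Matrix.diagonal V.diagEntries)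
        (JW ↥(maximalRealSubfield F) F a) (sMu F ι₁ V Φ a)).comp
      (finPairToAdelic ↥(maximalRealSubfield F) F (IsCMField.complexConj F) 3 1 (Matrix.diagonal V.diagEntries)
        (JW ↥(maximalRealSubfield F) F a)) =
    localRefSection ↥(maximalRealSubfield F) F (IsCMField.complexConj F) 3 1 finProdFinEquiv (Matrix.diagonal V.diagEntries)
      (JW ↥(maximalRealSubfield F) F a) (complexConj_imagUnit F) (imagUnit_ne_zero F) (imagUnit_mul_self F)
      (realDiagonal_isSymm F V.diagEntries V.complexConj_diagEntries) (isSymm_TW ↥(maximalRealSubfield F) a)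
      (realDiagonal_map F V.diagEntries V.complexConj_diagEntries).symm (JW_eq ↥(maximalRealSubfield F) F a)
      (muLocalSplittings F ι₁ V Φ a) := by
  obtain ⟨sa, ha⟩ := exists_isArchHalf F finProdFinEquiv V.diagEntries V.complexConj_diagEntries V.diagEntries_ne_zero
    (lineW F (TW ↥(maximalRealSubfield F) a)) (complexConj_lineW F (TW ↥(maximalRealSubfield F) a))
    (lineW_ne_zero F (TW ↥(maximalRealSubfield F) a) (isUnit_det_TW ↥(maximalRealSubfield F) a)) (chiMu F ι₁ Φ)
    (chiMu_isUnitary F ι₁ Φ) (chiMu_isSplittingChar F ι₁ Φ)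
  have hs := sMu_eq_splittingCongr_undoubleHom F ι₁ V Φ a
    (isDoubledWeilRep_assemble F finProdFinEquiv V.diagEntries V.complexConj_diagEntries V.diagEntries_ne_zero
      (lineW F (TW ↥(maximalRealSubfield F) a)) (complexConj_lineW F (TW ↥(maximalRealSubfield F) a))
      (lineW_ne_zero F (TW ↥(maximalRealSubfield F) a) (isUnit_det_TW ↥(maximalRealSubfield F) a)) (chiMu F ι₁ Φ)
      (finHalf_isFinHalf F finProdFinEquiv V.diagEntries V.complexConj_diagEntries V.diagEntries_ne_zero
        (lineW F (TW ↥(maximalRealSubfield F) a)) (complexConj_lineW F (TW ↥(maximalRealSubfield F) a))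
        (lineW_ne_zero F (TW ↥(maximalRealSubfield F) a) (isUnit_det_TW ↥(maximalRealSubfield F) a)) (chiMu F ι₁ Φ)
        (borelPlaceMeasure F)
        (cmFinLocalFamily F finProdFinEquiv V.diagEntries V.complexConj_diagEntries V.diagEntries_ne_zero
          (lineW F (TW ↥(maximalRealSubfield F) a)) (complexConj_lineW F (TW ↥(maximalRealSubfield F) a))
          (lineW_ne_zero F (TW ↥(maximalRealSubfield F) a) (isUnit_det_TW ↥(maximalRealSubfield F) a)) (chiMu F ι₁ Φ)
          (chiMu_isSplittingChar F ι₁ Φ) (borelPlaceMeasure F)))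
      ha)
  have key := pairSmall₁_splittingCongr_undoubleHom_assemble_eq_localRefSection F finProdFinEquiv V.diagEntries
    V.complexConj_diagEntries V.diagEntries_ne_zero (lineW F (TW ↥(maximalRealSubfield F) a))
    (complexConj_lineW F (TW ↥(maximalRealSubfield F) a))
    (lineW_ne_zero F (TW ↥(maximalRealSubfield F) a) (isUnit_det_TW ↥(maximalRealSubfield F) a)) (chiMu F ι₁ Φ)
    (borelPlaceMeasure F)
    (cmFinLocalFamily F finProdFinEquiv V.diagEntries V.complexConj_diagEntries V.diagEntries_ne_zero
      (lineW F (TW ↥(maximalRealSubfield F) a)) (complexConj_lineW F (TW ↥(maximalRealSubfield F) a))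
      (lineW_ne_zero F (TW ↥(maximalRealSubfield F) a) (isUnit_det_TW ↥(maximalRealSubfield F) a)) (chiMu F ι₁ Φ)
      (chiMu_isSplittingChar F ι₁ Φ) (borelPlaceMeasure F))
    (realDiagonal_lineW F (TW ↥(maximalRealSubfield F) a))
    (diagonal_lineW F (TW ↥(maximalRealSubfield F) a) (JW_eq ↥(maximalRealSubfield F) F a))
    (isSymm_TW ↥(maximalRealSubfield F) a) (JW_eq ↥(maximalRealSubfield F) F a) ha
  exact (congrArg (fun s => (pairSmall₁ ↥(maximalRealSubfield F) F (IsCMField.complexConj F) 3 1 finProdFinEquiv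
      (Matrix.diagonal V.diagEntries) (JW ↥(maximalRealSubfield F) F a) s).comp
    (finPairToAdelic ↥(maximalRealSubfield F) F (IsCMField.complexConj F) 3 1 (Matrix.diagonal V.diagEntries)
      (JW ↥(maximalRealSubfield F) F a))) hs).trans key

end Summit.HodgeConjecture.CorCM.Transposition.OmegaMuSplitting

end
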